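import Summits.QuantumFields.YangMills.Theses.RecentredCoverTransfer
import Summits.QuantumFields.YangMills.Theorems.RecentredCoverTransferCellDLRMeasurable
import HarnessLib

/-!
# Route `RecentredCoverTransfer` (LINE g9-D of planner ym-idea-1 g9), support item `CellCubeDLR` (stmt-QuantumFields-23165)

The one-cube DLR identity of a period cell: for a cube `(c, b)` whose 2-thickened window injects modulo the period lattice and a bounded
measurable cylinder observable `F` with links based in `[c, c + b]`, `∫ kerE_{(c,b)}(lift U)(F) dμ_C = ∫ F(lift U) dμ_C` — the theorem
`integral_kerE_cellLift_eq` of the kit `Theorems/RecentredCoverTransferCellDLRMeasurable` (the DLR equations of a skew torus for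
measurable observables, i.e. the tree's `PeriodCell.integral_lift_eq_integral_kernel_lift` without the continuity hypothesis, at
`Λ = cubeEdges c b`).

Width seat ym-line-sfw-p2-w3 g28 (cell ym-idea-1; free hands).  THEOREMS ONLY.  No crux, no rung (R2d ROT is a RECORD rung), no summit
and no mass gap is proved by this.
-/

set_option autoImplicit false

namespace Summit.QuantumFields.YangMills.Theorems.RecentredCoverTransfer

/-- **Item stmt-QuantumFields-23165 `RecentredCoverTransfer.CellCubeDLR` holds**: the cell law is Gibbs for the lattice Yang–Mills
specification on cubes below the injectivity radius. [cite: Georgii2011, Thm. 4.17 (4.18)] -/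
theorem cellCubeDLR_proof : Summit.QuantumFields.YangMills.Theses.RecentredCoverTransfer.CellCubeDLR := by
  intro G _ _ _ _ _ _ r Ce β c b hinj F hF hM SF hFS hSF
  obtain ⟨M, hM⟩ := hM
  exact integral_kerE_cellLift_eq r Ce β c b hinj F hF hM SF hFS hSF

end Summit.QuantumFields.YangMills.Theorems.RecentredCoverTransfer

/-! ## Registration under the «boundary-law» skeleton of crux `OnePointRate` (stmt-QuantumFields-23142)

The registered skeleton `Cruxes/OnePointRate` (LINE g9-D, planner ym-idea-1 g9) names this item as its stub 2,
`Summit.QuantumFields.YangMills.Cruxes.OnePointRate.BoundaryLaw.stub_cellCubeDLR : CellCubeDLR`; the declaration below records it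
BY NAME so that the crux registry sees the stub landed (appended 2026-08-28; previous declarations byte-identical). -/

namespace Summit.QuantumFields.YangMills.Cruxes.OnePointRate.BoundaryLaw

/-- **Stub 2 of «boundary-law» (crux stmt-QuantumFields-23142), BY NAME**: the one-cube DLR identity of a period cell
(= item stmt-QuantumFields-23165). [cite: Georgii2011, Thm. 4.17 (4.18)] -/
theorem stub_cellCubeDLR : Summit.QuantumFields.YangMills.Theses.RecentredCoverTransfer.CellCubeDLR :=
  Summit.QuantumFields.YangMills.Theorems.RecentredCoverTransfer.cellCubeDLR_proof

end Summit.QuantumFields.YangMills.Cruxes.OnePointRate.BoundaryLaw
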